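import Summits.Ventures.CertifiedManyBodySolver.Downfold.BoxesLa214V110
import Summits.Ventures.CertifiedManyBodySolver.Observables.StiffnessFillingSegmentLeaf
import Summits.Ventures.CertifiedManyBodySolver.Certificates.HubbardSquare_LaBoxE_stiffness_kinematic
import HarnessLib

/-!
# The S1/S2 seam for STIFFNESS words: a certified / kinematic stiffness ceiling on the delivered box of a
# one-band `OneBandBox` as a `HoldsOn` word, and the La₂CuO₄ parent box of record `boxLa214E_M13v110`

Venture CertifiedManyBodySolver, cell `pub/hubbard-downfold` (MO-S1 ↔ S2/S3 seam, D-0096; D-0150 line L-DF2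
«box ↦ certified word»), seat hubbard-downfold-unc-2 (`prover-hubbard-downfold-unc-2-g12-0`); namespace
`Summit.Ventures.CertifiedManyBodySolver.Downfold`. HONEST FRAMING: one-sided stiffness CEILINGS (helicity
modulus / superfluid weight) — a ceiling never speaks to the presence of order; not a `T_c` estimate, not a
superconductivity verdict; the kinematic words below are node-free kernel theorems (hubbard-tc p1), the certified
shapes are CONDITIONAL on the obligation they name; a downfolded box is a systematic modelling claim.

WHY. The director's M2(b) (2026-08-27): «La₂CuO₄ parent ↦ downfold box ↦ CERTIFIED stiffness ceiling over the
WHOLE box». The energy seam (`S2Seam.lean`, `Boxes*Words*.lean`) types energy windows on typed boxes; no stiffness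
word had been typed on a box of record. This file is the stiffness door:

* §1 GENERIC JOINS — `holdsOn_stiffnessSeqCeilingAt_of_cell` / `…thermal…`: a leaf `ObsStiffnessSeqCeilingAt s u n c`
  (resp. `ObsThermalStiffnessSeqCeilingAt`) proved on the product cell of the box's `tp/t`, `U/t`, `n` entries is the
  word `HoldsOn (p ↦ ObsStiffnessSeqCeilingAt (p tpOverT) (p UOverT) (p filling) c) B`; `…_of_s2Box` the same from
  S2's `Set.Icc lo hi ⊆ (Fin 3 → ℝ)` shape; `holdsOn_stiffnessSeqCeilingAt_tp0_of_rectangle` — for a `t' ≡ 0` box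
  the `(U-ray) × (filling segment)` rectangle leaf of `Observables/StiffnessFillingSegmentLeaf.lean` §3 (ONE
  kinetic-word certificate at `(U₀, n₀, 0)`, `U₀ ≤` the box's `U/t` floor, the filling entry inside the segment)
  IS the box word — «the box is decided at one anchor and the two ends of its filling entry»;
* §2 THE La₂CuO₄ PARENT BOX OF RECORD `boxLa214E_M13v110` (`U/t ∈ [5.9, 14.7]`, `t'/t ∈ [−0.3, −0.2]`,
  `n ∈ [0.99, 1.01]`): `boxLa214E_M13v110_stiffnessWord_of_cellLeaf` — the M2(b) OBLIGATION in the tree's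
  vocabulary (a leaf on the delivered cell ⇒ the box word); `boxLa214E_M13v110_stiffness_kinematic` /
  `…_thermalStiffness_kinematic` — TODAY'S UNCONDITIONAL WORDS: `ρ_s ≤ 0.4453763` (tree units, `t = 1`; HVR
  `D_s ≤ 0.2226882`) at every point of the box, ground-state and at every temperature, from hubbard-tc p1's kernel
  half-bathtub box leaves `laBoxE_x0_[thermal]stiffnessSeqLeaf`; `boxLa214E_M13v110_Tc_le_kinematic_KT` — the KT
  reading `T_c ≤ 0.3497978·t` CONDITIONAL on the monotonicity-free KT dictionary at the point. The certified
  (window-based) improvement below `0.4453763` on the WHOLE box waits on S2 rows at `t' ∈ [−0.3, −0.2]`, `n = 1`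
  carrying a density slope (`Rows/DopedTLCorrFilling.lean`) or box words on the cell; at the `t' = 0` control
  face the chord route gives `0.3132401` at `n = 1` (`Certificates/HubbardSquare_n1_U8_stiffness_control.lean`).

WHAT THIS IS NOT: a number of record beyond the kinematic ceiling; a phase sentence; informative vs print
(`ρ_s = 0` in the Mott insulator La₂CuO₄ — a ceiling is silent on zero).

References: T. Hazra, N. Verma, M. Randeria, PRX 9 (2019) 031049, eqs. (2)–(6) [HazraVermaRanderia2019];
D. J. Scalapino, S. R. White, S.-C. Zhang, PRB 47 (1993) 7995, §II [ScalapinoWhiteZhang1993]; R. B. Griffiths,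
J. Math. Phys. 7 (1966) 1215, §II [Griffiths1966].
-/

noncomputable section

namespace Summit.Ventures.CertifiedManyBodySolver.Downfold

open Set NonemptyInterval
open Summit.Ventures.CertifiedManyBodySolver.Observables
open Summit.Ventures.CertifiedManyBodySolver.Certificates

/-! ## §1 Generic joins: stiffness leaves on the delivered cell ⇒ box words -/

/-- **Ground-state stiffness leaf on the product cell ⇒ box word.** If `B` carries entries `eS, eU, eN` for
`tp/t`, `U/t`, `n` and `ObsStiffnessSeqCeilingAt s u n c` holds on `eS.encl × eU.encl × eN.encl`, then
`HoldsOn (p ↦ ObsStiffnessSeqCeilingAt (p tpOverT) (p UOverT) (p filling) c) B`. [cite: ScalapinoWhiteZhang1993, §II] -/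
theorem holdsOn_stiffnessSeqCeilingAt_of_cell {B : OneBandBox} {eS eU eN : Entry}
    (hS : B .tpOverT = some eS) (hU : B .UOverT = some eU) (hN : B .filling = some eN) {c : ℚ}
    (hW : ∀ s u n : ℝ, s ∈ eS.encl.ratCast ℝ → u ∈ eU.encl.ratCast ℝ → n ∈ eN.encl.ratCast ℝ →
      ObsStiffnessSeqCeilingAt s u n c) :
    HoldsOn (fun p : OneBandCoord → ℝ => ObsStiffnessSeqCeilingAt (p .tpOverT) (p .UOverT) (p .filling) c) B :=
  holdsOn_oneBand_of_cell hS hU hN (W₁ := fun s u n => ObsStiffnessSeqCeilingAt s u n c) hW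

/-- **Thermal stiffness leaf on the product cell ⇒ box word** (every temperature; the shape hubbard-tc's KT / XY
dictionaries read). [cite: HazraVermaRanderia2019, eqs. (2)-(6)] -/
theorem holdsOn_thermalStiffnessSeqCeilingAt_of_cell {B : OneBandBox} {eS eU eN : Entry}
    (hS : B .tpOverT = some eS) (hU : B .UOverT = some eU) (hN : B .filling = some eN) {c : ℚ}
    (hW : ∀ s u n : ℝ, s ∈ eS.encl.ratCast ℝ → u ∈ eU.encl.ratCast ℝ → n ∈ eN.encl.ratCast ℝ →
      ObsThermalStiffnessSeqCeilingAt s u n c) :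
    HoldsOn (fun p : OneBandCoord → ℝ =>
      ObsThermalStiffnessSeqCeilingAt (p .tpOverT) (p .UOverT) (p .filling) c) B :=
  holdsOn_oneBand_of_cell hS hU hN (W₁ := fun s u n => ObsThermalStiffnessSeqCeilingAt s u n c) hW

/-- **Stiffness leaf on S2's delivered box `Set.Icc (s2Lo …) (s2Hi …)` (order `(U/t, t'/t, n)`) ⇒ box word.**
[cite: ScalapinoWhiteZhang1993, §II] -/
theorem holdsOn_stiffnessSeqCeilingAt_of_s2Box {B : OneBandBox} {eU eS eN : Entry}
    (hU : B .UOverT = some eU) (hS : B .tpOverT = some eS) (hN : B .filling = some eN) {c : ℚ}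
    (hW : ∀ θ ∈ Set.Icc (s2Lo eU eS eN) (s2Hi eU eS eN), ObsStiffnessSeqCeilingAt (θ 1) (θ 0) (θ 2) c) :
    HoldsOn (fun p : OneBandCoord → ℝ => ObsStiffnessSeqCeilingAt (p .tpOverT) (p .UOverT) (p .filling) c) B :=
  holdsOn_of_forall_s2Box hU hS hN (W := fun θ => ObsStiffnessSeqCeilingAt (θ 1) (θ 0) (θ 2) c) hW

/-- **A `t' ≡ 0` box is decided at ONE anchor and the two ends of its filling entry.** If `B`'s `tp/t` entry is the
point `0`, its `U/t` entry starts at or above `U₀` and its filling entry lies inside `[n₁, n₂]`, then the rectangle leaf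
`∀ U ≥ U₀, ∀ x ∈ [n₁, n₂], ObsStiffnessSeqCeilingAt 0 U x c` (`Observables/StiffnessFillingSegmentLeaf.lean` §3: one
kinetic-word certificate at `(U₀, n₀, 0)` + two endpoint caps + a floor) is the box word. [cite: Griffiths1966, §II] -/
theorem holdsOn_stiffnessSeqCeilingAt_tp0_of_rectangle {B : OneBandBox} {eS eU eN : Entry}
    (hS : B .tpOverT = some eS) (hU : B .UOverT = some eU) (hN : B .filling = some eN)
    (hS0 : eS.encl.fst = 0) (hS0' : eS.encl.snd = 0) {U₀ n₁ n₂ : ℝ} (hU₀ : U₀ ≤ ((eU.encl.fst : ℚ) : ℝ))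
    (hn₁ : n₁ ≤ ((eN.encl.fst : ℚ) : ℝ)) (hn₂ : ((eN.encl.snd : ℚ) : ℝ) ≤ n₂) {c : ℚ}
    (hrect : ∀ U : ℝ, U₀ ≤ U → ∀ x ∈ Set.Icc n₁ n₂, ObsStiffnessSeqCeilingAt 0 U x c) :
    HoldsOn (fun p : OneBandCoord → ℝ => ObsStiffnessSeqCeilingAt (p .tpOverT) (p .UOverT) (p .filling) c) B := by
  refine holdsOn_stiffnessSeqCeilingAt_of_cell hS hU hN fun s u n hs hu hn => ?_
  rw [mem_ratCast_iff] at hs hu hn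
  have hs0 : s = 0 := by
    have h1 : ((eS.encl.fst : ℚ) : ℝ) = 0 := by rw [hS0]; push_cast; ring
    have h2 : ((eS.encl.snd : ℚ) : ℝ) = 0 := by rw [hS0']; push_cast; ring
    exact le_antisymm (h2 ▸ hs.2) (h1 ▸ hs.1)
  rw [hs0]
  exact hrect u (hU₀.trans hu.1) n ⟨hn₁.trans hn.1, hn.2.trans hn₂⟩

/-! ## §2 The La₂CuO₄ parent box of record `boxLa214E_M13v110` -/

/-- Coordinates of a point of the delivered La₂CuO₄ parent box `Set.Icc ![59/10, −3/10, 99/100] ![147/10, −1/5, 101/100]`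
(order `(U/t, t'/t, n)`). [folklore] -/
theorem mem_la214E_M13v110_s2Box {θ : Fin 3 → ℝ}
    (hθ : θ ∈ Set.Icc (![59/10, -3/10, 99/100] : Fin 3 → ℝ) ![147/10, -1/5, 101/100]) :
    (59 / 10 ≤ θ 0 ∧ θ 0 ≤ 147 / 10) ∧ (-3 / 10 ≤ θ 1 ∧ θ 1 ≤ -1 / 5) ∧ (99 / 100 ≤ θ 2 ∧ θ 2 ≤ 101 / 100) := by
  rw [Set.mem_Icc, Pi.le_def, Pi.le_def] at hθ
  obtain ⟨hlo, hhi⟩ := hθ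
  have h0 := hlo 0; have h1 := hlo 1; have h2 := hlo 2
  have h0' := hhi 0; have h1' := hhi 1; have h2' := hhi 2
  simp only [Matrix.cons_val_zero, Matrix.cons_val_one, Matrix.head_cons, Matrix.cons_val_two,
    Matrix.tail_cons] at h0 h1 h2 h0' h1' h2'
  exact ⟨⟨h0, h0'⟩, ⟨h1, h1'⟩, ⟨h2, h2'⟩⟩

/-- **The M2(b) obligation on the box of record, in the tree's vocabulary.** ANY ground-state stiffness leaf proved on the
delivered cell `U/t ∈ [5.9, 14.7] × t'/t ∈ [−0.3, −0.2] × n ∈ [0.99, 1.01]` of the La₂CuO₄ parent (a certified window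
row transported over the cell, a box word, or a kinematic bound) is the stiffness word on `boxLa214E_M13v110`.
[cite: ScalapinoWhiteZhang1993, §II] -/
theorem boxLa214E_M13v110_stiffnessWord_of_cellLeaf {c : ℚ}
    (hW : ∀ tp ∈ Set.Icc (-3 / 10 : ℝ) (-1 / 5), ∀ U ∈ Set.Icc (59 / 10 : ℝ) (147 / 10),
      ∀ n ∈ Set.Icc (99 / 100 : ℝ) (101 / 100), ObsStiffnessSeqCeilingAt tp U n c) :
    HoldsOn (fun p : OneBandCoord → ℝ => ObsStiffnessSeqCeilingAt (p .tpOverT) (p .UOverT) (p .filling) c)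
      boxLa214E_M13v110 := by
  refine holdsOn_of_forall_s2Box (B := boxLa214E_M13v110) (eU := la214E_v110_U) (eS := la214E_M13v19_tp)
    (eN := la214E_M13v19_n) boxLa214E_M13v110_U boxLa214E_M13v110_tp boxLa214E_M13v110_n
    (W := fun θ => ObsStiffnessSeqCeilingAt (θ 1) (θ 0) (θ 2) c) ?_
  rw [la214E_M13v110_s2Lo, la214E_M13v110_s2Hi]
  intro θ hθ
  obtain ⟨hUθ, htθ, hnθ⟩ := mem_la214E_M13v110_s2Box hθ
  exact hW (θ 1) htθ (θ 0) hUθ (θ 2) hnθ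

/-- **TODAY'S UNCONDITIONAL STIFFNESS WORD on the La₂CuO₄ parent box of record** (kinematic, node-free): at every point of
`boxLa214E_M13v110`, every uniform flux stiffness of the zero-flux sectors satisfies `ρ_s ≤ 0.4453763` (tree units, `t = 1`;
HVR `D_s ≤ 0.2226882`) — hubbard-tc p1's half-bathtub box leaf `laBoxE_x0_stiffnessSeqLeaf` on `t' ∈ [−0.3, −0.2]`, `n ≤ 1.01`,
every `U`, joined to the typed box. [cite: HazraVermaRanderia2019, eqs. (2)-(6)] -/
theorem boxLa214E_M13v110_stiffness_kinematic :
    HoldsOn (fun p : OneBandCoord → ℝ =>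
      ObsStiffnessSeqCeilingAt (p .tpOverT) (p .UOverT) (p .filling) (4453763 / 10000000)) boxLa214E_M13v110 :=
  boxLa214E_M13v110_stiffnessWord_of_cellLeaf fun _tp htp _U _ n hn =>
    laBoxE_x0_stiffnessSeqLeaf htp (by linarith [hn.1]) hn.2

/-- **The thermal twin** (every temperature): `ObsThermalStiffnessSeqCeilingAt (p tp) (p U) (p n) 0.4453763` at every point of
`boxLa214E_M13v110` (hubbard-tc p1's `laBoxE_x0_thermalStiffnessSeqLeaf`). [cite: ParamekantiTrivediRanderia1998, eq. (3) and §IV] -/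
theorem boxLa214E_M13v110_thermalStiffness_kinematic :
    HoldsOn (fun p : OneBandCoord → ℝ =>
      ObsThermalStiffnessSeqCeilingAt (p .tpOverT) (p .UOverT) (p .filling) (4453763 / 10000000)) boxLa214E_M13v110 := by
  refine holdsOn_of_forall_s2Box (B := boxLa214E_M13v110) (eU := la214E_v110_U) (eS := la214E_M13v19_tp)
    (eN := la214E_M13v19_n) boxLa214E_M13v110_U boxLa214E_M13v110_tp boxLa214E_M13v110_n
    (W := fun θ => ObsThermalStiffnessSeqCeilingAt (θ 1) (θ 0) (θ 2) (4453763 / 10000000)) ?_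
  rw [la214E_M13v110_s2Lo, la214E_M13v110_s2Hi]
  intro θ hθ
  obtain ⟨-, htθ, hnθ⟩ := mem_la214E_M13v110_s2Box hθ
  exact laBoxE_x0_thermalStiffnessSeqLeaf htθ (by linarith [hnθ.1]) hnθ.2

/-- **KT reading on the box of record** (CONDITIONAL on the monotonicity-free Kosterlitz–Thouless dictionary at the point,
hubbard-tc key K2/K3): at every point of `boxLa214E_M13v110`, every profile `(ρₑ, T_c)` satisfying `ThermalKTDictionaryAt`
has `T_c ≤ 0.3497978` (tree units `t = 1`; `(π/4)·0.4453763`). A ceiling on a transition temperature of the 2D single-layer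
MODEL; not a material `T_c`. [cite: HazraVermaRanderia2019, eqs. (2)-(3) and App. G] -/
theorem boxLa214E_M13v110_Tc_le_kinematic_KT :
    HoldsOn (fun p : OneBandCoord → ℝ => ∀ (ρe : ℝ → ℝ) (Tc : ℝ),
      ThermalKTDictionaryAt (p .tpOverT) (p .UOverT) (p .filling) ρe Tc → Tc ≤ 0.3497978) boxLa214E_M13v110 := by
  refine holdsOn_of_forall_s2Box (B := boxLa214E_M13v110) (eU := la214E_v110_U) (eS := la214E_M13v19_tp)
    (eN := la214E_M13v19_n) boxLa214E_M13v110_U boxLa214E_M13v110_tp boxLa214E_M13v110_n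
    (W := fun θ => ∀ (ρe : ℝ → ℝ) (Tc : ℝ), ThermalKTDictionaryAt (θ 1) (θ 0) (θ 2) ρe Tc → Tc ≤ 0.3497978) ?_
  rw [la214E_M13v110_s2Lo, la214E_M13v110_s2Hi]
  intro θ hθ ρe Tc hKT
  obtain ⟨-, htθ, hnθ⟩ := mem_la214E_M13v110_s2Box hθ
  exact Summit.Ventures.CertifiedManyBodySolver.Certificates.ThermalKTDictionaryAt.laBoxE_x0_le_decimal htθ
    (by linarith [hnθ.1]) hnθ.2 hKT

end Summit.Ventures.CertifiedManyBodySolver.Downfold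

end
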